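import Mathlib
import Summits.ResolutionOfSingularities.ResolutionOfSingularities.Theorems.FrobeniusClosingSteerPolarRankTwo
import Summits.ResolutionOfSingularities.ResolutionOfSingularities.Theorems.FrobeniusClosingSteerCotangentDerivationTwo

/-!
# Cotangent coordinates for quadratic parts in characteristic `2` (chain W4.1, crux `Steer`, B7)

OURS (campaign res-hironaka, rung L, slot W4.1; helper for crux `Steer` stmt-ResolutionOfSingularities-16345,
σ-residual LOW half, second layer of res-L0-w41-strat-2's one-step lemma B7 `rankFour_exit_two`). Pure local
algebra; NOT a statement of any manuscript; nothing here is attributed to [claim: Hironaka2017,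
status: under-review]. AI-written; weaker than expert review.

For a local ring `(R, 𝔪, κ)` with cotangent space `V = 𝔪/𝔪²` and lifts `u : Fin n → 𝔪` of a `κ`-basis of `V`:
* §1 `exists_coords` / `exists_cotangentBasis` — every `m ∈ 𝔪` is `Σ c_j u_j` modulo `𝔪²`; lifted bases exist;
* §2 `exists_matrix_of_mem_mul` — every `φ ∈ I·J` (`I, J ⊆ 𝔪`) is `Σ a_{jk} u_j u_k` modulo `𝔪³` with a
  coefficient matrix that is a SUM OF OUTER PRODUCTS of coordinate vectors of elements of `I` and of `J`
  (recorded through an additive predicate `C` on matrices);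
* §3 `polarRank_of_kernel` — characteristic `2`, residues squares: if the polar matrix
  `a_{jk} + a_{kj}`, pushed into SOME field `F` by a ring map `ψ` with `ψ⁻¹(0) ⊆ 𝔪`, has a non-zero
  kernel vector, then `Σ a_{jk} u_j u_k ≡ ℓ² + z·w (mod 𝔪³)` with `z, w ∈ 𝔪`
  (`PolarRank.pfaffian_eq_zero_of_kernel` + `PolarRank.quadratic_four`);
* §4 `exists_functional_of_ne_maximalIdeal` — for an ideal `Q ⊊ 𝔪` (so `Q + 𝔪² ≠ 𝔪`, Nakayama) a
  non-zero `κ`-vector `c` with `Σ_j m̄_j c_j = 0` for the coordinates of every `m ∈ Q`; hence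
  (`polarRank_of_mem_sq_of_ne_maximalIdeal`) `φ ∈ Q² ⇒ φ ≡ ℓ² + z·w (mod 𝔪³)` — the PERMISSIBLE-CENTRE
  case of B7;
(The point-step case — cotangent derivation and the relation count — is in the sibling file
`FrobeniusClosingSteerCotangentDerivationTwo.lean`.) [folklore]
-/

noncomputable section

-- `Summit.<S>.<S>.…` duplicates the summit name by design (single-problem summit).
set_option linter.dupNamespace false

namespace Summit.ResolutionOfSingularities.ResolutionOfSingularities.Theorems.SwitchingDichotomy.CotangentQuadratic

open IsLocalRing Module

universe u v

variable {R : Type u} [CommRing R] [IsLocalRing R]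

/-! ## §1 Coordinates modulo `𝔪²` -/

/-- **Coordinates**: if the classes of `u₀, …, u_{n-1} ∈ 𝔪` span `𝔪/𝔪²` over `κ`, every `m ∈ 𝔪` is
`Σ c_j u_j` modulo `𝔪²` for some `c_j ∈ R`, with `m̄ = Σ c̄_j ū_j` in `𝔪/𝔪²`. [folklore] -/
theorem exists_coords {n : ℕ} (u : Fin n → maximalIdeal R)
    (hu : Submodule.span (ResidueField R)
      (Set.range fun j => (maximalIdeal R).toCotangent (u j)) = ⊤)
    (m : R) (hm : m ∈ maximalIdeal R) :
    ∃ c : Fin n → R, m - ∑ j, c j * (u j : R) ∈ maximalIdeal R ^ 2 ∧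
      (maximalIdeal R).toCotangent ⟨m, hm⟩ =
        ∑ j, residue R (c j) • (maximalIdeal R).toCotangent (u j) := by
  have hmem : (maximalIdeal R).toCotangent ⟨m, hm⟩ ∈ Submodule.span (ResidueField R)
      (Set.range fun j => (maximalIdeal R).toCotangent (u j)) := by
    rw [hu]; trivial
  obtain ⟨cbar, hc⟩ := (Submodule.mem_span_range_iff_exists_fun _).mp hmem
  choose c hc' using fun j => Ideal.Quotient.mk_surjective (cbar j)
  refine ⟨c, ?_, ?_⟩
  · have hsum : (maximalIdeal R).toCotangent (∑ j, c j • u j) =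
        (maximalIdeal R).toCotangent ⟨m, hm⟩ := by
      rw [map_sum, ← hc]
      refine Finset.sum_congr rfl fun j _ => ?_
      rw [map_smul, ← hc' j]
      exact (CotangentDerivation.residue_smul (c j) _).symm
    have := (Ideal.toCotangent_eq (maximalIdeal R)).mp hsum.symm
    simpa [Submodule.coe_sum] using this
  · rw [← hc]
    refine Finset.sum_congr rfl fun j _ => ?_
    rw [← hc' j]
    rfl

/-- **Lifted cotangent bases exist**: if `dim_κ 𝔪/𝔪² = n` there are `u₀, …, u_{n-1} ∈ 𝔪` whose classes
form a `κ`-basis of `𝔪/𝔪²`. [folklore] -/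
theorem exists_cotangentBasis [IsNoetherianRing R] {n : ℕ}
    (hn : finrank (ResidueField R) (CotangentSpace R) = n) :
    ∃ u : Fin n → maximalIdeal R,
      LinearIndependent (ResidueField R) (fun j => (maximalIdeal R).toCotangent (u j)) ∧
      Submodule.span (ResidueField R) (Set.range fun j => (maximalIdeal R).toCotangent (u j)) = ⊤ := by
  let b := finBasisOfFinrankEq (ResidueField R) (CotangentSpace R) hn
  choose u hu using fun j => (maximalIdeal R).toCotangent_surjective (b j)
  have he : (fun j => (maximalIdeal R).toCotangent (u j)) = b := funext hu
  refine ⟨u, ?_, ?_⟩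
  · rw [he]; exact b.linearIndependent
  · rw [he]; exact b.span_eq

/-! ## §2 Products modulo `𝔪³` -/

omit [IsLocalRing R] in
/-- Products of three elements of an ideal lie in its cube. [folklore] -/
theorem mul_mul_mem_pow_three {I : Ideal R} {x y z : R} (hx : x ∈ I) (hy : y ∈ I) (hz : z ∈ I) :
    x * y * z ∈ I ^ 3 := by
  rw [pow_succ, pow_two]
  exact Ideal.mul_mem_mul (Ideal.mul_mem_mul hx hy) hz

omit [IsLocalRing R] in
/-- `𝔪 · 𝔪² ⊆ 𝔪³`. [folklore] -/
theorem mul_mem_pow_three_of_mem_of_mem_sq {I : Ideal R} {x y : R} (hx : x ∈ I) (hy : y ∈ I ^ 2) :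
    x * y ∈ I ^ 3 := by
  rw [show (3 : ℕ) = 1 + 2 by norm_num, pow_add, pow_one]
  exact Ideal.mul_mem_mul hx hy

/-- **Quadratic expressions for products**: with coordinates `m ≡ Σ c_j u_j`, `m' ≡ Σ c'_j u_j` modulo
`𝔪²`, `m m' ≡ Σ_{j,k} c_j c'_k u_j u_k` modulo `𝔪³`. [folklore] -/
theorem mul_sub_sum_mem {n : ℕ} (u : Fin n → maximalIdeal R) {m m' : R} (hm : m ∈ maximalIdeal R)
    {c c' : Fin n → R}
    (hc : m - ∑ j, c j * (u j : R) ∈ maximalIdeal R ^ 2)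
    (hc' : m' - ∑ j, c' j * (u j : R) ∈ maximalIdeal R ^ 2) :
    m * m' - ∑ j, ∑ k, (c j * c' k) * (u j : R) * (u k : R) ∈ maximalIdeal R ^ 3 := by
  have hsum : ∑ j, ∑ k, (c j * c' k) * (u j : R) * (u k : R) =
      (∑ j, c j * (u j : R)) * (∑ k, c' k * (u k : R)) := by
    rw [Finset.sum_mul_sum]
    refine Finset.sum_congr rfl fun j _ => Finset.sum_congr rfl fun k _ => by ring
  have hS : ∑ k, c' k * (u k : R) ∈ maximalIdeal R :=
    Ideal.sum_mem _ fun k _ => Ideal.mul_mem_left _ _ (u k).2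
  have e : m * m' - ∑ j, ∑ k, (c j * c' k) * (u j : R) * (u k : R) =
      m * (m' - ∑ k, c' k * (u k : R)) +
        (m - ∑ j, c j * (u j : R)) * (∑ k, c' k * (u k : R)) := by
    rw [hsum]; ring
  rw [e]
  refine add_mem (mul_mem_pow_three_of_mem_of_mem_sq hm hc') ?_
  rw [mul_comm]
  exact mul_mem_pow_three_of_mem_of_mem_sq hS hc

/-- **Every `φ ∈ I · J` (`I, J ⊆ 𝔪`) is a quadratic expression `Σ a_{jk} u_j u_k` modulo `𝔪³`** whose
coefficient matrix is a sum of outer products `c ⊗ c'` of coordinate vectors of elements of `I` and `J`;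
this provenance is recorded by any predicate `C` stable under `+` and containing those outer products. [folklore] -/
theorem exists_matrix_of_mem_mul {n : ℕ} (u : Fin n → maximalIdeal R)
    (hu : Submodule.span (ResidueField R)
      (Set.range fun j => (maximalIdeal R).toCotangent (u j)) = ⊤)
    (C : (Fin n → Fin n → R) → Prop) (hCadd : ∀ a b, C a → C b → C (a + b))
    (I J : Ideal R) (hI : I ≤ maximalIdeal R) (hJ : J ≤ maximalIdeal R)
    (hCprod : ∀ m ∈ I, ∀ m' ∈ J, ∀ c c' : Fin n → R,
      m - ∑ j, c j * (u j : R) ∈ maximalIdeal R ^ 2 → m' - ∑ j, c' j * (u j : R) ∈ maximalIdeal R ^ 2 →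
      C (fun j k => c j * c' k))
    {φ : R} (hφ : φ ∈ I * J) :
    ∃ a : Fin n → Fin n → R, C a ∧
      φ - ∑ j, ∑ k, a j k * (u j : R) * (u k : R) ∈ maximalIdeal R ^ 3 := by
  refine Submodule.mul_induction_on hφ ?_ ?_
  · intro m hm m' hm'
    obtain ⟨c, hc, -⟩ := exists_coords u hu m (hI hm)
    obtain ⟨c', hc', -⟩ := exists_coords u hu m' (hJ hm')
    exact ⟨fun j k => c j * c' k, hCprod m hm m' hm' c c' hc hc',
      mul_sub_sum_mem u (hI hm) hc hc'⟩
  · intro x y hx hy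
    obtain ⟨a, ha, hxa⟩ := hx
    obtain ⟨b, hb, hyb⟩ := hy
    refine ⟨a + b, hCadd a b ha hb, ?_⟩
    have e : x + y - ∑ j, ∑ k, (a + b) j k * (u j : R) * (u k : R) =
        (x - ∑ j, ∑ k, a j k * (u j : R) * (u k : R)) +
          (y - ∑ j, ∑ k, b j k * (u j : R) * (u k : R)) := by
      simp only [Pi.add_apply, add_mul, Finset.sum_add_distrib]
      ring
    rw [e]
    exact add_mem hxa hyb

/-! ## §3 The endgame: a kernel vector of the polar matrix in some field -/

/-- **Polar rank `≤ 2` from a kernel vector** (characteristic `2`, residues squares): if the polar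
matrix `(a_{jk} + a_{kj})`, pushed into a field `F` along a ring map `ψ` whose kernel lies in `𝔪`, kills a
non-zero vector, then `Σ_{j,k<4} a_{jk} u_j u_k ≡ ℓ² + z·w (mod 𝔪³)` with `z, w ∈ 𝔪`: the Pfaffian
vanishes in `F` (`PolarRank.pfaffian_eq_zero_of_kernel`), hence lies in `𝔪`, and
`PolarRank.quadratic_four` applies. [folklore] -/
theorem polarRank_of_kernel [CharP R 2] (hperf : ∀ a : R, ∃ b : R, a - b ^ 2 ∈ maximalIdeal R)
    (a : Fin 4 → Fin 4 → R) (u : Fin 4 → R) (hu : ∀ j, u j ∈ maximalIdeal R)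
    {F : Type v} [Field F] [CharP F 2] (ψ : R →+* F) (hψ : ∀ r, ψ r = 0 → r ∈ maximalIdeal R)
    (c : Fin 4 → F) (hc : c ≠ 0) (hker : ∀ k, ∑ j, ψ (a j k + a k j) * c j = 0) :
    ∃ ℓ z w : R, z ∈ maximalIdeal R ∧ w ∈ maximalIdeal R ∧
      (∑ j, ∑ k, a j k * u j * u k) - ℓ ^ 2 - z * w ∈ maximalIdeal R ^ 3 := by
  have h2 : (2 : F) = 0 := by
    have := CharP.cast_eq_zero F 2
    simpa using this
  have hdiag : ∀ j, ψ (a j j + a j j) = 0 := fun j => by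
    rw [← two_mul, map_mul, map_ofNat, h2, zero_mul]
  have hsymm : ∀ j k, ψ (a k j + a j k) = ψ (a j k + a k j) := fun j k => by rw [add_comm]
  -- the four kernel equations, unfolded
  have e := fun k => (hker k)
  simp only [Fin.sum_univ_four] at e
  have e0 := e 0
  have e1 := e 1
  have e2 := e 2
  have e3 := e 3
  rw [hdiag 0, zero_mul, zero_add, hsymm 0 1, hsymm 0 2, hsymm 0 3] at e0
  rw [hdiag 1, zero_mul, hsymm 1 2, hsymm 1 3] at e1
  rw [hdiag 2, zero_mul, hsymm 2 3] at e2
  rw [hdiag 3, zero_mul, add_zero] at e3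
  have hpf := PolarRank.pfaffian_eq_zero_of_kernel (ψ (a 0 1 + a 1 0)) (ψ (a 0 2 + a 2 0))
    (ψ (a 0 3 + a 3 0)) (ψ (a 1 2 + a 2 1)) (ψ (a 1 3 + a 3 1)) (ψ (a 2 3 + a 3 2)) c hc
    (by linear_combination e0) (by linear_combination e1) (by linear_combination e2)
    (by linear_combination e3)
  refine PolarRank.quadratic_four hperf a u hu (hψ _ ?_)
  simpa [map_add, map_mul] using hpf

/-! ## §4 The permissible-centre case: an ideal `Q ⊊ 𝔪` -/

/-- **A functional killing `Q` modulo `𝔪²`**: for an ideal `Q ⊆ 𝔪`, `Q ≠ 𝔪`, of a Noetherian local ring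
and lifts `u` of a `κ`-basis of `𝔪/𝔪²`, there is a non-zero `κ`-vector `c` with `Σ_j c̄'_j c_j = 0` for the
coordinates `c'` of every `m ∈ Q` (the image of `Q` in `𝔪/𝔪²` is a proper subspace: were it everything,
`Q + 𝔪² = 𝔪` and `Q = 𝔪` by Nakayama). [folklore] -/
theorem exists_functional_of_ne_maximalIdeal [IsNoetherianRing R] {n : ℕ} (u : Fin n → maximalIdeal R)
    (hli : LinearIndependent (ResidueField R) (fun j => (maximalIdeal R).toCotangent (u j)))
    (hu : Submodule.span (ResidueField R)
      (Set.range fun j => (maximalIdeal R).toCotangent (u j)) = ⊤)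
    (Q : Ideal R) (hQ : Q ≤ maximalIdeal R) (hne : Q ≠ maximalIdeal R) :
    ∃ c : Fin n → ResidueField R, c ≠ 0 ∧
      ∀ m ∈ Q, ∀ c' : Fin n → R, m - ∑ j, c' j * (u j : R) ∈ maximalIdeal R ^ 2 →
        ∑ j, residue R (c' j) * c j = 0 := by
  classical
  -- the image `W` of `Q` in the cotangent space is a proper subspace
  set s : Set (maximalIdeal R) := {m | (m : R) ∈ Q} with hs
  set W : Submodule (ResidueField R) (CotangentSpace R) :=
    Submodule.span (ResidueField R) ((maximalIdeal R).toCotangent '' s) with hW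
  have hWtop : W ≠ ⊤ := by
    intro htop
    apply hne
    have h := (CotangentSpace.span_image_eq_top_iff (R := R) (s := s)).mp htop
    refine le_antisymm hQ ?_
    intro m hm
    have hms : (⟨m, hm⟩ : maximalIdeal R) ∈ Submodule.span R s := by rw [h]; trivial
    change ((⟨m, hm⟩ : maximalIdeal R) : R) ∈ Q
    refine Submodule.span_induction
      (p := fun (x : maximalIdeal R) (_ : x ∈ Submodule.span R s) => (x : R) ∈ Q) ?_ ?_ ?_ ?_ hms
    · intro x hx; exact hx
    · exact Q.zero_mem
    · intro x y _ _ hx hy; exact Q.add_mem hx hy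
    · intro r x _ hx
      show r • (x : R) ∈ Q
      rw [smul_eq_mul]
      exact Q.mul_mem_left r hx
  obtain ⟨f, hf0, hfW⟩ := Submodule.exists_dual_map_eq_bot_of_lt_top (lt_top_iff_ne_top.mpr hWtop)
    inferInstance
  have hfW' : ∀ w ∈ W, f w = 0 := fun w hw => by
    have : f w ∈ W.map f := Submodule.mem_map_of_mem hw
    rw [hfW] at this
    exact (Submodule.mem_bot _).mp this
  -- `c_j := f (ū_j)`
  let b : Basis (Fin n) (ResidueField R) (CotangentSpace R) := Basis.mk hli (le_of_eq hu.symm)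
  have hb : ∀ j, b j = (maximalIdeal R).toCotangent (u j) := fun j => Basis.mk_apply hli _ j
  refine ⟨fun j => f ((maximalIdeal R).toCotangent (u j)), ?_, ?_⟩
  · intro hc
    apply hf0
    refine b.ext fun j => ?_
    rw [hb, LinearMap.zero_apply]
    exact congr_fun hc j
  · intro m hm c' hc'
    have hmM : m ∈ maximalIdeal R := hQ hm
    obtain ⟨d, -, hd⟩ := exists_coords u hu m hmM
    -- the coordinates `c'` agree with `d` modulo `𝔪` (basis), so we may compute with the class of `m`
    have hclass : (maximalIdeal R).toCotangent ⟨m, hmM⟩ =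
        ∑ j, residue R (c' j) • (maximalIdeal R).toCotangent (u j) := by
      have hsum : (maximalIdeal R).toCotangent (∑ j, c' j • u j) =
          ∑ j, residue R (c' j) • (maximalIdeal R).toCotangent (u j) := by
        rw [map_sum]
        refine Finset.sum_congr rfl fun j _ => ?_
        rw [map_smul, CotangentDerivation.residue_smul]
      rw [← hsum, Ideal.toCotangent_eq]
      simpa [Submodule.coe_sum] using hc'
    have hfm : f ((maximalIdeal R).toCotangent ⟨m, hmM⟩) = 0 :=
      hfW' _ (Submodule.subset_span ⟨⟨m, hmM⟩, hm, rfl⟩)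
    rw [hclass, map_sum] at hfm
    simpa [map_smul, smul_eq_mul] using hfm

/-- **B7, permissible-centre case (local algebra)**: in a Noetherian local ring of characteristic `2` of
embedding dimension `4` whose residues are squares, if `φ ∈ Q²` for an ideal `Q ⊆ 𝔪` with `Q ≠ 𝔪`, then
`φ ≡ ℓ² + z·w (mod 𝔪³)` with `z, w ∈ 𝔪` (the alternating form `Σ p̄_t ∧ q̄_t` of `φ = Σ p_t q_t` lives on
the proper subspace `(Q + 𝔪²)/𝔪²`, so a non-zero functional kills it). [folklore] -/
theorem polarRank_of_mem_sq_of_ne_maximalIdeal [IsNoetherianRing R] [CharP R 2]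
    (hperf : ∀ a : R, ∃ b : R, a - b ^ 2 ∈ maximalIdeal R)
    (h4 : finrank (ResidueField R) (CotangentSpace R) = 4)
    (Q : Ideal R) (hQ : Q ≤ maximalIdeal R) (hne : Q ≠ maximalIdeal R) {φ : R} (hφ : φ ∈ Q ^ 2) :
    ∃ g z w : R, z ∈ maximalIdeal R ∧ w ∈ maximalIdeal R ∧
      φ - g ^ 2 - z * w ∈ maximalIdeal R ^ 3 := by
  haveI : CharP (ResidueField R) 2 := by
    haveI : Nontrivial (ResidueField R) := inferInstance
    have h0 : ((2 : ℕ) : ResidueField R) = 0 := by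
      have : ((2 : ℕ) : R) = 0 := CharP.cast_eq_zero R 2
      rw [← map_natCast (residue R), this, map_zero]
    exact (CharP.charP_iff_prime_eq_zero Nat.prime_two).mpr h0
  obtain ⟨u, hli, hu⟩ := exists_cotangentBasis (R := R) h4
  obtain ⟨c, hc0, hc⟩ := exists_functional_of_ne_maximalIdeal u hli hu Q hQ hne
  -- provenance predicate: the polar matrix, pushed to `κ`, kills `c`
  let C : (Fin 4 → Fin 4 → R) → Prop := fun a =>
    ∀ k, ∑ j, residue R (a j k + a k j) * c j = 0
  have hCadd : ∀ a b, C a → C b → C (a + b) := fun a b ha hb k => by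
    have := congrArg₂ (· + ·) (ha k) (hb k)
    simp only [add_zero] at this
    rw [← this, ← Finset.sum_add_distrib]
    refine Finset.sum_congr rfl fun j _ => ?_
    simp only [Pi.add_apply, map_add]
    ring
  have hCprod : ∀ m ∈ Q, ∀ m' ∈ Q, ∀ d d' : Fin 4 → R,
      m - ∑ j, d j * (u j : R) ∈ maximalIdeal R ^ 2 → m' - ∑ j, d' j * (u j : R) ∈ maximalIdeal R ^ 2 →
      C (fun j k => d j * d' k) := by
    intro m hm m' hm' d d' hd hd' k
    have h1 := hc m hm d hd
    have h2 := hc m' hm' d' hd'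
    have e : ∑ j, residue R (d j * d' k + d k * d' j) * c j =
        residue R (d' k) * ∑ j, residue R (d j) * c j +
          residue R (d k) * ∑ j, residue R (d' j) * c j := by
      rw [Finset.mul_sum, Finset.mul_sum, ← Finset.sum_add_distrib]
      refine Finset.sum_congr rfl fun j _ => ?_
      simp only [map_add, map_mul]
      ring
    rw [e, h1, h2, mul_zero, mul_zero, add_zero]
  rw [pow_two] at hφ
  obtain ⟨a, ha, hφa⟩ := exists_matrix_of_mem_mul u hu C hCadd Q Q hQ hQ hCprod hφ
  obtain ⟨ℓ, z, w, hz, hw, h⟩ := polarRank_of_kernel hperf a (fun j => (u j : R)) (fun j => (u j).2)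
    (residue R) (fun r hr => (residue_eq_zero_iff r).mp hr) c hc0 ha
  refine ⟨ℓ, z, w, hz, hw, ?_⟩
  have e : φ - ℓ ^ 2 - z * w =
      (φ - ∑ j, ∑ k, a j k * (u j : R) * (u k : R)) +
        ((∑ j, ∑ k, a j k * (u j : R) * (u k : R)) - ℓ ^ 2 - z * w) := by ring
  rw [e]
  exact add_mem hφa h


end Summit.ResolutionOfSingularities.ResolutionOfSingularities.Theorems.SwitchingDichotomy.CotangentQuadratic

end
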